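import Mathlib
import Summits.Ventures.HodgeRepro2.T5HaarCosetAverage

/-!
# T5HaarProbability — the Haar probability measure of a compact additive group, and the coset-average
identity / the Gauss-sum integral for it and an OPEN subgroup (ideal) of finite index

Kernel support for Tier 5, sub-step N5 / §G, reading residual [R-4] (route/T5-LEAN-p7.md §22 (b)(iv): the
modelling clause). `T5HaarCosetAverage` and `T5KudlaGaussSum` take «a left-invariant probability measure `μ` on
`𝒪` and a measurable subgroup / ideal of finite index» as hypotheses. On a COMPACT additive group (such as
`𝒪_v`, a profinite ring) these are not hypotheses but facts: Mathlib's `addHaarMeasure ⊤`, the Haar measure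
normalised by the whole group, is a left-invariant probability measure (`haarProb`), and an open subgroup is
measurable. So:

* `haarProb` := `addHaarMeasure (⊤ : PositiveCompacts A)`; instances `IsProbabilityMeasure haarProb`,
  `haarProb.IsAddLeftInvariant`;
* `integral_comp_mk_haarProb`: the coset average for `haarProb` and an OPEN subgroup `N` of finite index;
* `integral_mulChar_mul_addChar_haarProb` / `sqrt_card_mul_integral_eq_gNorm_haarProb`: Kudla's integral against
  `haarProb` over a compact topological ring `𝒪` and an OPEN ideal `I` of finite index is the (normalised) finite
  Gauss sum on `𝒪 ⧸ I`.

Nothing about local fields is defined: `𝒪_v` enters as «a compact topological commutative ring with the Borel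
σ-algebra», `𝔭^n` as «an open ideal of finite index».
-/

namespace Summit.Ventures.HodgeRepro2.T5HaarProbability

open MeasureTheory
open Summit.Ventures.HodgeRepro2.T5LocalRingGaussSum
open Summit.Ventures.HodgeRepro2.T5HaarCosetAverage

section Group

variable (A : Type*) [AddCommGroup A] [TopologicalSpace A] [IsTopologicalAddGroup A]
  [CompactSpace A] [Nonempty A] [MeasurableSpace A] [BorelSpace A]

/-- The Haar probability measure of a compact additive group: the Haar measure normalised so that the
whole group has measure `1` («`vol(𝒪_v) = 1`»). -/
noncomputable def haarProb : Measure A := Measure.addHaarMeasure (⊤ : TopologicalSpace.PositiveCompacts A)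

/-- `haarProb` is a probability measure. -/
instance isProbabilityMeasure_haarProb : IsProbabilityMeasure (haarProb A) :=
  ⟨by rw [haarProb, ← TopologicalSpace.PositiveCompacts.coe_top, Measure.addHaarMeasure_self]⟩

/-- `haarProb` is left invariant (it is a Haar measure). -/
instance isAddLeftInvariant_haarProb : (haarProb A).IsAddLeftInvariant := by
  unfold haarProb
  infer_instance

variable {A}

/-- **Coset average for the Haar probability measure.** For an OPEN subgroup `N` of finite index of a
compact additive group, `∫ f(x mod N) d(haarProb) = |A/N|⁻¹ · Σ_{c ∈ A/N} f(c)`. -/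
theorem integral_comp_mk_haarProb (N : AddSubgroup A) [Fintype (A ⧸ N)] (hN : IsOpen (N : Set A))
    (f : A ⧸ N → ℂ) :
    ∫ x, f (QuotientAddGroup.mk x) ∂(haarProb A) = (Fintype.card (A ⧸ N) : ℂ)⁻¹ * ∑ c, f c :=
  integral_comp_mk (haarProb A) N hN.measurableSet f

/-- The Haar probability measure of an open subgroup of finite index is `|A/N|⁻¹`. -/
theorem haarProb_addSubgroup (N : AddSubgroup A) [Fintype (A ⧸ N)] (hN : IsOpen (N : Set A)) :
    haarProb A N = (Fintype.card (A ⧸ N) : ENNReal)⁻¹ :=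
  measure_addSubgroup_eq_inv_card (haarProb A) N hN.measurableSet

end Group

section Ring

variable {𝒪 : Type*} [CommRing 𝒪] [TopologicalSpace 𝒪] [IsTopologicalAddGroup 𝒪] [CompactSpace 𝒪]
  [MeasurableSpace 𝒪] [BorelSpace 𝒪] (I : Ideal 𝒪) [Fintype (𝒪 ⧸ I)]

/-- **Kudla's integral against the Haar probability measure is the finite Gauss sum**, for an OPEN ideal
`I` of finite index of a compact topological ring. -/
theorem integral_mulChar_mul_addChar_haarProb (hI : IsOpen (I : Set 𝒪)) (χ : MulChar (𝒪 ⧸ I) ℂ)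
    (ψ : AddChar (𝒪 ⧸ I) ℂ) :
    ∫ y, χ (Ideal.Quotient.mk I y) * ψ (Ideal.Quotient.mk I y) ∂(haarProb 𝒪)
      = (Fintype.card (𝒪 ⧸ I) : ℂ)⁻¹ * gaussSum χ ψ :=
  integral_mulChar_mul_addChar (haarProb 𝒪) I hI.measurableSet χ ψ

/-- `√|𝒪/I| · ∫_𝒪 χ(π y) ψ(π y) d(haarProb) = gNorm χ ψ` for an open ideal `I` of finite index. -/
theorem sqrt_card_mul_integral_eq_gNorm_haarProb (hI : IsOpen (I : Set 𝒪)) (χ : MulChar (𝒪 ⧸ I) ℂ)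
    (ψ : AddChar (𝒪 ⧸ I) ℂ) :
    ((Real.sqrt (Fintype.card (𝒪 ⧸ I)) : ℝ) : ℂ)
        * ∫ y, χ (Ideal.Quotient.mk I y) * ψ (Ideal.Quotient.mk I y) ∂(haarProb 𝒪)
      = gNorm χ ψ :=
  sqrt_card_mul_integral_eq_gNorm (haarProb 𝒪) I hI.measurableSet χ ψ

end Ring

end Summit.Ventures.HodgeRepro2.T5HaarProbability
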